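/-
Literature file (hubbard-downfold multi-orbital front-end): the Slater–Racah parametrisation of the
d-shell two-index Coulomb integrals `U_{mm'}`, `J_{mm'}` in the basis of real (cubic) harmonics, and the
exact dictionary between the «U» objects of the different schools (Slater-averaged `F⁰`, intra-orbital
`U₀`, Kanamori `(U, U', J)`, Anisimov `(U_avg, J_avg)`), which are routinely compared with each other in
the downfolding literature although they are different numbers for one and the same vertex.
-/
import Mathlib
import HarnessLib

/-!
# d-shell Coulomb integrals in Slater/Racah parameters and the `U' = U − 2J` dictionary

For a d shell whose Coulomb vertex is parametrised atomically (spherically) by the Slater integrals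
`F⁰, F², F⁴`, the two-index integrals in the basis of the five REAL harmonics
`xy, yz, 3z²−r², xz, x²−y²` are (Pavarini 2011, §3 p. 6.13, U-table; App. B p. 6.36, matrices `c₂`, `c₄`
and the Racah parameters `A = F⁰ − 49 F⁴/441`, `B = F²/49 − 5 F⁴/441`, `C = 35 F⁴/441`):

* intra-orbital `U_{mm} = U₀ = F⁰ + 4F²/49 + 36F⁴/441 = A + 4B + 3C` for every `m`;
* exchange `J_{mm'}` (`m ≠ m'`) takes four values
  `J₁ = 3F²/49 + 20F⁴/441 = 3B + C` (pairs `xy–yz, xy–xz, yz–xz, yz–(x²−y²), xz–(x²−y²)`),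
  `J₂ = 4F²/49 + 15F⁴/441 = 4B + C` (`xy–z², z²–(x²−y²)`), `J₃ = 35F⁴/441 = C` (`xy–(x²−y²)`),
  `J₄ = F²/49 + 30F⁴/441 = B + C` (`z²–yz, z²–xz`);
* inter-orbital `U_{mm'} = U₀ − 2 J_{mm'}` for every pair `m ≠ m'` (the printed U-table), i.e.
  `A − 2B + C`, `A − 4B + C`, `A + 4B + C`, `A + 2B + C` for the four pair classes.

Everything below is PROVED from the explicit coefficient tables (each identity is a polynomial identity
in `F⁰, F², F⁴`); the modelling input is only the two tables `uPair`, `jPair`.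

## Contents (all exact)

* `uPair_eq_uIntra_sub_two_jPair` — `U_{mm'} = U₀ − 2J_{mm'}` for all `m ≠ m'` («`U' = U − 2J`» holds for
  EVERY pair of real d orbitals under the spherical parametrisation, not only inside `t₂g`).
* `kanamori_t2g` — on the `t₂g` triple `{xy, yz, xz}` the vertex is of Kanamori form with
  `U = U₀`, `U' = F⁰ − 2F²/49 − 4F⁴/441`, `J = J₁`, and `U' = U − 2J` (Georges–de' Medici–Mravlje 2013 §2).
* `pairSum_uPair` — the all-pairs average `(1/25) Σ_{m,m'} U_{mm'} = F⁰` (=: `U_avg`, the Slater-averaged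
  «U» of the constrained-LDA school, Anisimov et al. 1997);
  `offDiagSum_jPair` — the real-harmonic exchange average `(1/20) Σ_{m≠m'} J_{mm'} = (5/7)·J_avg` with
  `J_avg := (F² + F⁴)/14`; `offDiagSum_uPair` — `(1/20) Σ_{m≠m'} U_{mm'} = F⁰ − (2/7) J_avg`;
  `anisimov_identity` — `U_avg − J_avg = (1/20) Σ_{m≠m'} (U_{mm'} − J_{mm'})`.
* `uIntra_eq_F0_add` — THE SCHOOL OFFSET: `U₀ = F⁰ + (8/7)·J_avg`, ratio-free (no assumption on `F⁴/F²`):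
  the intra-orbital (cRPA-matrix-diagonal / Kanamori) `U` and the Slater-averaged `F⁰` of the SAME vertex
  differ by exactly `8J_avg/7` (≈ 0.9 eV at `J_avg = 0.8 eV`); `diagAvg_uPair` — the «average of the diagonal
  terms» `Ū := (1/5) Σ_m U_{mm}` (the object tabulated e.g. by Miyake et al. 2010, Table IX) equals `U₀`,
  hence `Ū − U_avg = 8J_avg/7` exactly.
* `pavarini_J_relations` — `J₂ = 3J₁ − 2𝒥`, `J₃ = 6𝒥 − 5J₁`, `J₄ = 4𝒥 − 3J₁` with `𝒥 = (5/7)J_avg`.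
* `werner2012_witness` — numerical witness: with `F⁰ = 2.70 eV`, `J_avg = 0.8 eV`, `F⁴/F² = 5/8`
  (so `F² = 448/65`, `F⁴ = 56/13`) the five distinct entries of the symmetrised opposite-spin matrix are
  `U₀ = 3.614…, 2.380…, 2.196…, 2.930…, 2.747…`, each within `0.01` eV of the printed
  `3.61, 2.38, 2.20, 2.93, 2.74` of Werner et al. 2012 (Supplement, Eq. for `U^{σσ̄}_{mn}(J = 0.8)`), whose
  authors state that the matrix was obtained by exactly this Slater reconstruction from `Ū^{σσ̄} = 2.70` and
  `J = 0.8`.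

WHAT THIS IS NOT: a statement about any material's cRPA matrix — measured cRPA matrices in Wannier
bases are NOT spherically parametrised (e.g. LaFeAsO d-model `U_{xy,xy} − U_{xy,yz} = 3.03 − 1.80 ≠ 2·0.46`,
Miyake et al. 2010 Table VIII) and orbital-dependent `U_{mm}` occur; the identities say exactly what the
symmetrised/atomic parametrisation used by DMFT solvers and by the cLDA school implies, so that numbers
labelled «U» by different schools are converted, never hulled (hubbard-downfold ROUTER rule R21 / A10).

## References

* E. Pavarini, *The LDA+DMFT Approach*, Ch. 6 in: E. Pavarini, E. Koch, D. Vollhardt, A. Lichtenstein (eds.),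
  The LDA+DMFT approach to strongly correlated materials, Modeling and Simulation Vol. 1, Forschungszentrum
  Jülich (2011), §3 p. 6.13 (average parameters, U-table, `U₀`, `J₁…J₄`, `𝒥_avg = 5/7 J_avg`) and App. B
  p. 6.36 (`c₂`, `c₄`, Racah `A, B, C`). [Pavarini2011]
* V. I. Anisimov, F. Aryasetiawan, A. I. Lichtenstein, J. Phys.: Condens. Matter 9 (1997) 767, §2
  (`U = F⁰`, `J = (F²+F⁴)/14`, `F⁴/F² ≈ 0.625`). [AnisimovAryasetiawanLichtenstein1997]
* A. Georges, L. de' Medici, J. Mravlje, Annu. Rev. Condens. Matter Phys. 4 (2013) 137, §2 (t₂g Kanamori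
  `U, U' = U − 2J, J` in Slater/Racah parameters; `U_d = F⁰`, `J_H = (F²+F⁴)/14` «should not be confused with»
  the t₂g `U, J`) and App. A (e_g doublet `J = 4B + C`, `U' = U − 2J`). [GeorgesMediciMravlje2013]
* P. Werner, M. Casula, T. Miyake, F. Aryasetiawan, A. J. Millis, S. Biermann, Nature Phys. 8 (2012) 331,
  Supplementary Information §2.1 (symmetrised `U^{σσ̄}_{mn}`, `U^{σσ}_{mn}` for BaFe₂As₂ from `Ū = 2.70`,
  `J = 0.8` eV). [WernerEtAl2012]
* T. Miyake, K. Nakamura, R. Arita, M. Imada, J. Phys. Soc. Jpn. 79 (2010) 044705, Tables VIII–IX. [MiyakeEtAl2010]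
-/

noncomputable section

namespace Literature.MathematicalPhysics.QuantumManyBody

namespace DShellSlaterKanamori

/-! ## Orbitals, pair classes and the two coefficient tables -/

/-- The five real (cubic) d harmonics, in the order of Pavarini's U-table:
`xy, yz, 3z²−r² (=: z2), xz, x²−y² (=: x2y2)`. [cite: Pavarini2011, §3 p. 6.13 (U-table)] -/
inductive DOrb
  | xy
  | yz
  | z2
  | xz
  | x2y2

open DOrb

/-- The four exchange classes of Pavarini's U-table plus the diagonal: `same` (`m = m'`),
`k1` ↔ `J₁` (pairs `xy–yz, xy–xz, yz–xz, yz–(x²−y²), xz–(x²−y²)`), `k2` ↔ `J₂` (`xy–z², z²–(x²−y²)`),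
`k3` ↔ `J₃` (`xy–(x²−y²)`), `k4` ↔ `J₄` (`z²–yz, z²–xz`). [cite: Pavarini2011, §3 p. 6.13 (U-table)] -/
inductive PairKind
  | same
  | k1
  | k2
  | k3
  | k4

/-- The class of an ordered pair of real d orbitals (symmetric by construction; all 25 cases listed).
[cite: Pavarini2011, §3 p. 6.13 (U-table)] -/
def pairKind : DOrb → DOrb → PairKind
  | xy, xy => .same
  | yz, yz => .same
  | z2, z2 => .same
  | xz, xz => .same
  | x2y2, x2y2 => .same
  | xy, yz => .k1
  | yz, xy => .k1
  | xy, xz => .k1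
  | xz, xy => .k1
  | yz, xz => .k1
  | xz, yz => .k1
  | yz, x2y2 => .k1
  | x2y2, yz => .k1
  | xz, x2y2 => .k1
  | x2y2, xz => .k1
  | xy, z2 => .k2
  | z2, xy => .k2
  | z2, x2y2 => .k2
  | x2y2, z2 => .k2
  | xy, x2y2 => .k3
  | x2y2, xy => .k3
  | yz, z2 => .k4
  | z2, yz => .k4
  | xz, z2 => .k4
  | z2, xz => .k4

/-- Intra-orbital Coulomb integral `U₀ = U_{mm} = F⁰ + (4/49)F² + (36/441)F⁴` (the same for all five real
d orbitals). [cite: Pavarini2011, App. B p. 6.36 (diagonal of c₂ = 4/49, c₄ = 36/441) and §3 p. 6.13 (U₀)] -/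
def uIntra (F0 F2 F4 : ℝ) : ℝ := F0 + 4 / 49 * F2 + 36 / 441 * F4

/-- Exchange integral by pair class: `J₁ = 3F²/49 + 20F⁴/441`, `J₂ = 4F²/49 + 15F⁴/441`, `J₃ = 35F⁴/441`,
`J₄ = F²/49 + 30F⁴/441`; on the diagonal the two-index «exchange» integral coincides with `U_{mm}`.
[cite: Pavarini2011, App. B p. 6.36 (off-diagonal entries of c₂, c₄) and §3 p. 6.13 (J₁)] -/
def jOfKind (F0 F2 F4 : ℝ) : PairKind → ℝ
  | .same => uIntra F0 F2 F4
  | .k1 => 3 / 49 * F2 + 20 / 441 * F4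
  | .k2 => 4 / 49 * F2 + 15 / 441 * F4
  | .k3 => 35 / 441 * F4
  | .k4 => 1 / 49 * F2 + 30 / 441 * F4

/-- Direct (inter-orbital) integral by pair class, written out in Slater integrals:
`k1: F⁰ − 2F²/49 − 4F⁴/441`, `k2: F⁰ − 4F²/49 + 6F⁴/441`, `k3: F⁰ + 4F²/49 − 34F⁴/441`,
`k4: F⁰ + 2F²/49 − 24F⁴/441`, diagonal `U₀` (these are the entries `U₀ − 2Jᵢ` of the printed U-table,
expanded). [cite: Pavarini2011, §3 p. 6.13 (U-table `U₀ − 2Jᵢ`)] -/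
def uOfKind (F0 F2 F4 : ℝ) : PairKind → ℝ
  | .same => uIntra F0 F2 F4
  | .k1 => F0 - 2 / 49 * F2 - 4 / 441 * F4
  | .k2 => F0 - 4 / 49 * F2 + 6 / 441 * F4
  | .k3 => F0 + 4 / 49 * F2 - 34 / 441 * F4
  | .k4 => F0 + 2 / 49 * F2 - 24 / 441 * F4

/-- The exchange table `J_{mm'}` of the real d shell. [cite: Pavarini2011, App. B p. 6.36 (c₂, c₄)] -/
def jPair (F0 F2 F4 : ℝ) (m m' : DOrb) : ℝ := jOfKind F0 F2 F4 (pairKind m m')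

/-- The direct table `U_{mm'}` of the real d shell. [cite: Pavarini2011, §3 p. 6.13 (U-table)] -/
def uPair (F0 F2 F4 : ℝ) (m m' : DOrb) : ℝ := uOfKind F0 F2 F4 (pairKind m m')

/-- Racah `A = F⁰ − 49F⁴/441`. [cite: Pavarini2011, App. B p. 6.36] -/
def racahA (F0 F4 : ℝ) : ℝ := F0 - 49 / 441 * F4

/-- Racah `B = F²/49 − 5F⁴/441`. [cite: Pavarini2011, App. B p. 6.36] -/
def racahB (F2 F4 : ℝ) : ℝ := F2 / 49 - 5 / 441 * F4

/-- Racah `C = 35F⁴/441`. [cite: Pavarini2011, App. B p. 6.36] -/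
def racahC (F4 : ℝ) : ℝ := 35 / 441 * F4

/-- The Slater-averaged exchange of the cLDA school, `J_avg := (F² + F⁴)/14` (Anisimov–Aryasetiawan–Lichtenstein).
[cite: Pavarini2011, §3 p. 6.13 («J_avg = (F₂+F₄)/14»); AnisimovAryasetiawanLichtenstein1997, §2] -/
def jAvg (F2 F4 : ℝ) : ℝ := (F2 + F4) / 14

/-- Sum of `f` over the five real d orbitals (explicit, instance-free). [folklore] -/
def orbSum (f : DOrb → ℝ) : ℝ := f xy + f yz + f z2 + f xz + f x2y2

/-- Sum of `f` over all 25 ordered orbital pairs. [folklore] -/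
def pairSum (f : DOrb → DOrb → ℝ) : ℝ := orbSum fun m => orbSum fun m' => f m m'

/-- Sum of `f` over the 20 ordered off-diagonal pairs `m ≠ m'`. [folklore] -/
def offDiagSum (f : DOrb → DOrb → ℝ) : ℝ := pairSum f - orbSum fun m => f m m

/-- The `t₂g` orbitals `xy, yz, xz`. [cite: GeorgesMediciMravlje2013, §2.1] -/
def IsT2g : DOrb → Prop
  | xy => True
  | yz => True
  | xz => True
  | z2 => False
  | x2y2 => False

/-! ## Symmetry and the diagonal -/

/-- The pair class is symmetric. [cite: Pavarini2011, §3 p. 6.13 (U-table is symmetric)] -/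
theorem pairKind_symm (m m' : DOrb) : pairKind m m' = pairKind m' m := by
  cases m <;> cases m' <;> rfl

/-- `U_{mm'} = U_{m'm}`. [cite: Pavarini2011, §3 p. 6.13] -/
theorem uPair_symm (F0 F2 F4 : ℝ) (m m' : DOrb) : uPair F0 F2 F4 m m' = uPair F0 F2 F4 m' m := by
  simp only [uPair, pairKind_symm m m']

/-- `J_{mm'} = J_{m'm}`. [cite: Pavarini2011, App. B p. 6.36 (c₂, c₄ symmetric)] -/
theorem jPair_symm (F0 F2 F4 : ℝ) (m m' : DOrb) : jPair F0 F2 F4 m m' = jPair F0 F2 F4 m' m := by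
  simp only [jPair, pairKind_symm m m']

/-- `pairKind m m = same`. [folklore] -/
private theorem pairKind_self (m : DOrb) : pairKind m m = .same := by
  cases m <;> rfl

/-- `U_{mm} = U₀` for every real d orbital. [cite: Pavarini2011, §3 p. 6.13 (diagonal of the U-table)] -/
theorem uPair_self (F0 F2 F4 : ℝ) (m : DOrb) : uPair F0 F2 F4 m m = uIntra F0 F2 F4 := by
  simp only [uPair, pairKind_self, uOfKind]

/-- `J_{mm} = U_{mm}` (two-index convention). [cite: Pavarini2011, App. B p. 6.36 (diagonal of c₂, c₄)] -/
theorem jPair_self (F0 F2 F4 : ℝ) (m : DOrb) : jPair F0 F2 F4 m m = uIntra F0 F2 F4 := by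
  simp only [jPair, pairKind_self, jOfKind]

/-- `pairKind m m' = same` only on the diagonal. [folklore] -/
private theorem pairKind_ne_same {m m' : DOrb} (h : m ≠ m') : pairKind m m' ≠ .same := by
  cases m <;> cases m' <;> first | exact absurd rfl h | simp [pairKind]

/-! ## `U' = U − 2J` for every pair, Racah forms, Kanamori `t₂g` block -/

/-- Class-wise form of the U-table: `U(k) = U₀ − 2 J(k)` for each off-diagonal class. [cite: Pavarini2011, §3 p. 6.13] -/
theorem uOfKind_eq (F0 F2 F4 : ℝ) (k : PairKind) (hk : k ≠ .same) :
    uOfKind F0 F2 F4 k = uIntra F0 F2 F4 - 2 * jOfKind F0 F2 F4 k := by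
  cases k with
  | same => exact absurd rfl hk
  | k1 => simp only [uOfKind, uIntra, jOfKind]; ring
  | k2 => simp only [uOfKind, uIntra, jOfKind]; ring
  | k3 => simp only [uOfKind, uIntra, jOfKind]; ring
  | k4 => simp only [uOfKind, uIntra, jOfKind]; ring

/-- **`U_{mm'} = U_{mm} − 2 J_{mm'}` for EVERY pair `m ≠ m'` of real d orbitals** (spherically parametrised
vertex): the printed U-table. [cite: Pavarini2011, §3 p. 6.13 (U-table, entries `U₀ − 2Jᵢ`)] -/
theorem uPair_eq_uIntra_sub_two_jPair (F0 F2 F4 : ℝ) {m m' : DOrb} (h : m ≠ m') :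
    uPair F0 F2 F4 m m' = uIntra F0 F2 F4 - 2 * jPair F0 F2 F4 m m' := by
  simp only [uPair, jPair]
  exact uOfKind_eq F0 F2 F4 _ (pairKind_ne_same h)

/-- Racah forms: `U₀ = A + 4B + 3C`, `J₁ = 3B + C`, `J₂ = 4B + C`, `J₃ = C`, `J₄ = B + C`.
[cite: Pavarini2011, App. B p. 6.36 (Racah A, B, C) with §3 p. 6.13] -/
theorem racah_forms (F0 F2 F4 : ℝ) :
    uIntra F0 F2 F4 = racahA F0 F4 + 4 * racahB F2 F4 + 3 * racahC F4 ∧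
    jOfKind F0 F2 F4 .k1 = 3 * racahB F2 F4 + racahC F4 ∧
    jOfKind F0 F2 F4 .k2 = 4 * racahB F2 F4 + racahC F4 ∧
    jOfKind F0 F2 F4 .k3 = racahC F4 ∧
    jOfKind F0 F2 F4 .k4 = racahB F2 F4 + racahC F4 := by
  refine ⟨?_, ?_, ?_, ?_, ?_⟩ <;> simp only [uIntra, jOfKind, racahA, racahB, racahC] <;> ring

/-- Racah forms of the inter-orbital integrals: `A − 2B + C`, `A − 4B + C`, `A + 4B + C`, `A + 2B + C` for the
classes `k1…k4`. [cite: Pavarini2011, §3 p. 6.13 (U-table) with App. B p. 6.36 (Racah A, B, C)] -/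
theorem racah_forms_inter (F0 F2 F4 : ℝ) :
    uOfKind F0 F2 F4 .k1 = racahA F0 F4 - 2 * racahB F2 F4 + racahC F4 ∧
    uOfKind F0 F2 F4 .k2 = racahA F0 F4 - 4 * racahB F2 F4 + racahC F4 ∧
    uOfKind F0 F2 F4 .k3 = racahA F0 F4 + 4 * racahB F2 F4 + racahC F4 ∧
    uOfKind F0 F2 F4 .k4 = racahA F0 F4 + 2 * racahB F2 F4 + racahC F4 := by
  refine ⟨?_, ?_, ?_, ?_⟩ <;> simp only [uOfKind, racahA, racahB, racahC] <;> ring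

/-- **Kanamori form of the `t₂g` block**: for `m ≠ m'` both in `{xy, yz, xz}`,
`U_{mm} = U₀`, `U_{mm'} = U' := F⁰ − 2F²/49 − 4F⁴/441`, `J_{mm'} = J := 3F²/49 + 20F⁴/441`, and `U' = U₀ − 2J`.
[cite: GeorgesMediciMravlje2013, §2 (t₂g shell: `U = F⁰ + 4F²/49 + 4F⁴/49 = A + 4B + 3C`,
`U' = F⁰ − 2F²/49 − 4F⁴/441 = A − 2B + C = U − 2J`, `J = 3F²/49 + 20F⁴/441 = 3B + C`); Pavarini2011, §3 p. 6.13] -/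
theorem kanamori_t2g (F0 F2 F4 : ℝ) {m m' : DOrb} (hm : IsT2g m) (hm' : IsT2g m') (h : m ≠ m') :
    uPair F0 F2 F4 m m' = F0 - 2 / 49 * F2 - 4 / 441 * F4 ∧
    jPair F0 F2 F4 m m' = 3 / 49 * F2 + 20 / 441 * F4 ∧
    uPair F0 F2 F4 m m' = uIntra F0 F2 F4 - 2 * jPair F0 F2 F4 m m' := by
  refine ⟨?_, ?_, uPair_eq_uIntra_sub_two_jPair F0 F2 F4 h⟩ <;>
    cases m <;> cases m' <;>
      first
        | exact absurd rfl h
        | exact (hm.elim : False).elim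
        | exact (hm'.elim : False).elim
        | simp [uPair, jPair, pairKind, uOfKind, jOfKind]

/-- The `e_g` pair `(3z²−r², x²−y²)`: `J = J₂ = 4F²/49 + 15F⁴/441` and `U' = U₀ − 2J₂ = F⁰ − 4F²/49 + 6F⁴/441`.
[cite: Pavarini2011, App. B p. 6.36 (c₂ = 4, c₄ = 15 for the pair z²–(x²−y²)) and §3 p. 6.13 (U₀ − 2J₂);
GeorgesMediciMravlje2013, App. A (e_g doublet: `J = 4B + C`, `U' = U − 2J` by cubic symmetry)] -/
theorem eg_pair (F0 F2 F4 : ℝ) :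
    jPair F0 F2 F4 z2 x2y2 = 4 / 49 * F2 + 15 / 441 * F4 ∧
    uPair F0 F2 F4 z2 x2y2 = F0 - 4 / 49 * F2 + 6 / 441 * F4 := by
  simp [uPair, jPair, pairKind, uOfKind, jOfKind]

/-! ## Averages: the school dictionary -/

/-- `Σ_m f m` unfolds to the five-term sum. [folklore] -/
private theorem orbSum_def (f : DOrb → ℝ) : orbSum f = f xy + f yz + f z2 + f xz + f x2y2 := rfl

/-- **All-pairs average = F⁰**: `Σ_{m,m'} U_{mm'} = 25 F⁰`, i.e. `U_avg := (1/25) Σ U_{mm'} = F⁰` — the «U» of the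
constrained-LDA school. [cite: Pavarini2011, §3 p. 6.13 («U_avg = (1/(2l+1)²) Σ U_{m,m'} = F₀»)] -/
theorem pairSum_uPair (F0 F2 F4 : ℝ) : pairSum (uPair F0 F2 F4) = 25 * F0 := by
  simp only [pairSum, orbSum_def, uPair, pairKind, uOfKind, uIntra]
  ring

/-- `(1/25) Σ_{m,m'} U_{mm'} = F⁰`. [cite: Pavarini2011, §3 p. 6.13] -/
theorem uAvg_eq_F0 (F0 F2 F4 : ℝ) : pairSum (uPair F0 F2 F4) / 25 = F0 := by
  rw [pairSum_uPair]; ring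

/-- **Real-harmonic exchange average**: `Σ_{m≠m'} J_{mm'} = 20·(5/7)·J_avg`, i.e.
`𝒥_avg := (1/20) Σ_{m≠m'} J_{mm'} = (5/7) J_avg`. [cite: Pavarini2011, §3 p. 6.13 («𝒥_avg = 5/7 J_avg»)] -/
theorem offDiagSum_jPair (F0 F2 F4 : ℝ) :
    offDiagSum (jPair F0 F2 F4) = 20 * (5 / 7 * jAvg F2 F4) := by
  simp only [offDiagSum, pairSum, orbSum_def, jPair, pairKind, jOfKind, uIntra, jAvg]
  ring

/-- `(1/20) Σ_{m≠m'} J_{mm'} = (5/7)·J_avg = 5(F²+F⁴)/98`. [cite: Pavarini2011, §3 p. 6.13] -/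
theorem jRealAvg_eq (F0 F2 F4 : ℝ) :
    offDiagSum (jPair F0 F2 F4) / 20 = 5 / 7 * jAvg F2 F4 := by
  rw [offDiagSum_jPair]; ring

/-- **Inter-orbital average**: `(1/20) Σ_{m≠m'} U_{mm'} = F⁰ − (2/7) J_avg`.
[cite: Pavarini2011, §3 p. 6.13 (U-table with `U₀ = U_avg + 8/7 J_avg`, `𝒥_avg = 5/7 J_avg`)] -/
theorem offDiagSum_uPair (F0 F2 F4 : ℝ) :
    offDiagSum (uPair F0 F2 F4) / 20 = F0 - 2 / 7 * jAvg F2 F4 := by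
  simp only [offDiagSum, pairSum, orbSum_def, uPair, pairKind, uOfKind, uIntra, jAvg]
  ring

/-- **Anisimov's defining identity**: with `U_avg := F⁰` and `J_avg := (F²+F⁴)/14`,
`U_avg − J_avg = (1/20) Σ_{m≠m'} (U_{mm'} − J_{mm'})`.
[cite: Pavarini2011, §3 p. 6.13 («U_avg − J_avg = (1/(2l(2l+1))) Σ (U − J)»); AnisimovAryasetiawanLichtenstein1997, §2] -/
theorem anisimov_identity (F0 F2 F4 : ℝ) :
    F0 - jAvg F2 F4 = offDiagSum (fun m m' => uPair F0 F2 F4 m m' - jPair F0 F2 F4 m m') / 20 := by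
  simp only [offDiagSum, pairSum, orbSum_def, uPair, jPair, pairKind, uOfKind, jOfKind, uIntra, jAvg]
  ring

/-- **THE SCHOOL OFFSET (ratio-free)**: `U₀ = F⁰ + (8/7)·J_avg` — the intra-orbital `U` exceeds the
Slater-averaged `U_avg = F⁰` of the same vertex by exactly `8 J_avg/7`, whatever `F⁴/F²` is.
[cite: Pavarini2011, §3 p. 6.13 («U₀ = U_avg + 8/7 J_avg = U_avg + 8/5 𝒥_avg»)] -/
theorem uIntra_eq_F0_add (F0 F2 F4 : ℝ) : uIntra F0 F2 F4 = F0 + 8 / 7 * jAvg F2 F4 := by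
  simp only [uIntra, jAvg]; ring

/-- The same offset through the real-harmonic average: `U₀ = U_avg + (8/5)·𝒥_avg`. [cite: Pavarini2011, §3 p. 6.13] -/
theorem uIntra_eq_F0_add' (F0 F2 F4 : ℝ) :
    uIntra F0 F2 F4 = F0 + 8 / 5 * (offDiagSum (jPair F0 F2 F4) / 20) := by
  rw [jRealAvg_eq, uIntra_eq_F0_add]; ring

/-- **Average of the DIAGONAL terms** `Ū := (1/5) Σ_m U_{mm}` (the object tabulated as «Ū, average of the
diagonal terms of the screened interaction», e.g. Miyake et al. 2010 Table IX) equals `U₀`, hence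
`Ū = U_avg + 8J_avg/7`: a diagonal-average «U» and an all-pairs-average «U» of one vertex are different numbers.
[cite: Pavarini2011, §3 p. 6.13; MiyakeEtAl2010, Table IX (definition of Ū)] -/
theorem diagAvg_uPair (F0 F2 F4 : ℝ) :
    orbSum (fun m => uPair F0 F2 F4 m m) / 5 = uIntra F0 F2 F4 ∧
    orbSum (fun m => uPair F0 F2 F4 m m) / 5 - pairSum (uPair F0 F2 F4) / 25 = 8 / 7 * jAvg F2 F4 := by
  refine ⟨?_, ?_⟩
  · simp only [orbSum_def, uPair_self]; ring
  · rw [pairSum_uPair]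
    simp only [orbSum_def, uPair_self, uIntra, jAvg]
    ring

/-- Pavarini's relations among the four exchange values, with `𝒥 = (5/7) J_avg`:
`J₂ = 3J₁ − 2𝒥`, `J₃ = 6𝒥 − 5J₁`, `J₄ = 4𝒥 − 3J₁`. [cite: Pavarini2011, §3 p. 6.13] -/
theorem pavarini_J_relations (F0 F2 F4 : ℝ) :
    jOfKind F0 F2 F4 .k2 = 3 * jOfKind F0 F2 F4 .k1 - 2 * (5 / 7 * jAvg F2 F4) ∧
    jOfKind F0 F2 F4 .k3 = 6 * (5 / 7 * jAvg F2 F4) - 5 * jOfKind F0 F2 F4 .k1 ∧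
    jOfKind F0 F2 F4 .k4 = 4 * (5 / 7 * jAvg F2 F4) - 3 * jOfKind F0 F2 F4 .k1 := by
  refine ⟨?_, ?_, ?_⟩ <;> simp only [jOfKind, jAvg] <;> ring

/-- With the conventional ratio `F⁴/F² = 5/8`: `F² = (112/13) J_avg`, `F⁴ = (70/13) J_avg`, and the `t₂g`
Kanamori exchange is `J₁ = (4424/5733)·J_avg ≈ 0.772 J_avg` while `𝒥_avg = (5/7) J_avg ≈ 0.714 J_avg` — three
different «J» numbers for one vertex. [cite: Pavarini2011, §3 p. 6.13 («F₄/F₂ ∼ 0.625 = 5/8»)] -/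
theorem ratio_five_eighths (F0 F2 F4 : ℝ) (h : F4 = 5 / 8 * F2) :
    F2 = 112 / 13 * jAvg F2 F4 ∧ F4 = 70 / 13 * jAvg F2 F4 ∧
    jOfKind F0 F2 F4 .k1 = 4424 / 5733 * jAvg F2 F4 := by
  subst h
  refine ⟨?_, ?_, ?_⟩ <;> simp only [jAvg, jOfKind] <;> ring

/-! ## Numerical witness (Werner et al. 2012, BaFe₂As₂, symmetrised cRPA matrix) -/

/-- **Witness.** Werner et al. reconstruct the opposite-spin matrix `U^{σσ̄}_{mn}` of BaFe₂As₂ from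
`Ū^{σσ̄} = 2.70 eV` (all-pairs average, i.e. `F⁰`) and `J = 0.8 eV` (i.e. `J_avg`) with `F⁴/F² = 5/8`
(`F² = 448/65`, `F⁴ = 56/13`); the Slater tables then give the five distinct entries
`U₀ ≈ 3.614`, `k1 ≈ 2.380`, `k2 ≈ 2.196`, `k3 ≈ 2.930`, `k4 ≈ 2.747` eV, each within `0.01` eV of the printed
`3.61, 2.38, 2.20, 2.93, 2.74`, and the printed same-spin entries `U − J` (`1.76, 1.49, 2.58, 2.31`) likewise.
[cite: WernerEtAl2012, Supplementary Information §2.1 (matrices `U^{σσ̄}_{mn}(J=0.8)`, `U^{σσ}_{mn}(J=0.8)`)] -/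
theorem werner2012_witness :
    let F0 : ℝ := 27 / 10
    let F2 : ℝ := 448 / 65
    let F4 : ℝ := 56 / 13
    jAvg F2 F4 = 4 / 5 ∧ F4 = 5 / 8 * F2 ∧
    |uIntra F0 F2 F4 - 3.61| ≤ 0.01 ∧
    |uOfKind F0 F2 F4 .k1 - 2.38| ≤ 0.01 ∧ |uOfKind F0 F2 F4 .k2 - 2.20| ≤ 0.01 ∧
    |uOfKind F0 F2 F4 .k3 - 2.93| ≤ 0.01 ∧ |uOfKind F0 F2 F4 .k4 - 2.74| ≤ 0.01 ∧
    |uOfKind F0 F2 F4 .k1 - jOfKind F0 F2 F4 .k1 - 1.76| ≤ 0.01 ∧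
    |uOfKind F0 F2 F4 .k2 - jOfKind F0 F2 F4 .k2 - 1.49| ≤ 0.01 ∧
    |uOfKind F0 F2 F4 .k3 - jOfKind F0 F2 F4 .k3 - 2.58| ≤ 0.01 ∧
    |uOfKind F0 F2 F4 .k4 - jOfKind F0 F2 F4 .k4 - 2.31| ≤ 0.01 := by
  simp only [jAvg, uIntra, uOfKind, jOfKind]
  refine ⟨by norm_num, by norm_num, ?_, ?_, ?_, ?_, ?_, ?_, ?_, ?_, ?_⟩ <;>
    (rw [abs_le]; constructor <;> norm_num)

end DShellSlaterKanamori

end Literature.MathematicalPhysics.QuantumManyBody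

end
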